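import Summits.ABC.ABC.Theses.IneffectiveSubspace
import Summits.ABC.ABC.Theorems.IneffectiveSubspaceUniformSadicTowerFourHarmonicThueRothCore
import Summits.ABC.ABC.Theorems.IneffectiveSubspaceTowerFourSubLiouvilleStubFixedFormsRoth
import Summits.ABC.ABC.Theorems.IneffectiveSubspaceUniformSadicTowerFourGaussianNormalForm

/-!
# Thue's theorem for the harmonic quartic family, from Roth: the cell is finite for each `m` (stmt-ABC-14937)

Support file of line `SketchIdeator4` (crux `UniformSadicTowerFour`, card
`Cruxes/UniformSadicTowerFour/Ideas/gaussian-thue-pell-square.md`).  The SIZE half of the Pell-square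
cell `1 + t² = m·n⁴` is the open atom `W₄` (`QuarticRootWall.quarticRootWall_of_uniformSadicTowerFour`:
`n ≪_ε` a power of the data, UNIFORMLY).  What IS a theorem — and is proved here, unconditionally, from
Roth's theorem as proved in the tree (`Literature…roth_holds`, through
`TowerFourSubLiouville.fixedFormsRoth_approx`) — is the qualitative, per-form statement (Thue 1909):

* `harmonicThue_norm_bounded` — for every `μ ∈ ℤ[i]` the harmonic quartic Thue equation
  `Im(μ·ν⁴) = ±1` has only finitely many solutions `ν` (a bound on `N(ν)`).
* `cell_modulus_bounded` — hence for every `m` the cell `1 + t² = m·n⁴` has bounded `n`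
  (`X² + 1 = mY⁴` has finitely many solutions), through the landed `ℤ[i]` normal form
  `GaussianNormalForm.thueSolution_of_cell`;
* `quarticRoot_cofactor_unbounded` — equivalently, along `n⁴ ∣ t² + 1` the cofactor `(t² + 1)/n⁴`
  tends to infinity: `(t²+1)/n⁴ ≤ B ⟹ t ≤ X₀(B)` — the exact `x² + 1` twin of
  `FourthPowerDivisor.fourthPowerDivisor_cofactor_unbounded` (lead a1, p111600).  Ineffective, no rate;
  `W₄` asks for the rate `n³ ≪_ε t^(1+ε)`.

Proof of the first (root by root, no irreducibility needed).  Put `w = μ ∈ ℂ` (`Im w ≠ 0`; for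
`Im μ = 0` there are no solutions, `4 ∣ Im(μν⁴)`), `z = ν`, `q = z/z̄`, `ρ = w̄/w`.  A solution has
`|Im(wz⁴)| = 1`, so `‖q⁴ − ρ‖ = 2/(‖w‖‖z‖⁴)` (`degree_four_gap`); by nearest-root separation
(`Core.exists_near_fourth_root`) some fourth root `ζ = (α+i)/(α−i)` of `ρ` (`α = 2·Im ζ/‖ζ−1‖²` real
algebraic, `Core`) has `‖q − ζ‖ ≤ 6/(‖w‖‖z‖⁴)`, i.e. by the Möbius chart `|e − αf| ≤ c/‖z‖³`
(`z = e + fi`); with `‖z‖ ≥ |f|` this is `|α − e/f| ≤ c/f⁴`, and Roth (`p = 3 < 4`; rational `α` included)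
bounds `f`, then `e`.
-/

-- `Summit.<Summit>.<Problem>` is the mandated summit-side namespace (CONVENTIONS §2); for the
-- single-conjunct summit `ABC` the two coincide, so the duplicate `ABC.ABC` is deliberate.
set_option linter.dupNamespace false

namespace Summit.ABC.ABC.Theorems.UniformSadicTowerFour.HarmonicThueRoth

open Complex
open scoped ComplexConjugate
open Summit.ABC.ABC.Theorems

/-! ## Small facts about Gaussian integers as complex numbers -/

/-- A Gaussian integer is algebraic over `ℚ` as a complex number (`i² + 1 = 0`). [folklore] -/
theorem isAlgebraic_toComplex (x : GaussianInt) : IsAlgebraic ℚ (x : ℂ) := by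
  have hI : IsAlgebraic ℚ I := by
    refine ⟨Polynomial.X ^ 2 + 1, ?_, ?_⟩
    · exact Polynomial.X_pow_add_C_ne_zero (by norm_num) 1
    · simp
  rw [GaussianInt.toComplex_def]
  exact (isAlgebraic_int _).add ((isAlgebraic_int _).mul hI)

/-- A nonzero Gaussian integer has complex norm `≥ 1`. [folklore] -/
theorem one_le_norm_toComplex {x : GaussianInt} (hx : x ≠ 0) : 1 ≤ ‖(x : ℂ)‖ := by
  have h1 : (1 : ℝ) ≤ ‖(x : ℂ)‖ ^ 2 := by
    rw [Complex.sq_norm, ← GaussianInt.intCast_real_norm]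
    have := GaussianInt.norm_pos.mpr hx
    exact_mod_cast this
  nlinarith [norm_nonneg (x : ℂ)]

/-- `|Re z|, |Im z| ≤ ‖z‖` in the form used below: `|(x.im : ℝ)| ≤ ‖(x : ℂ)‖`. [folklore] -/
theorem abs_im_le_norm_toComplex (x : GaussianInt) : |((x.im : ℤ) : ℝ)| ≤ ‖(x : ℂ)‖ := by
  rw [GaussianInt.intCast_im]; exact Complex.abs_im_le_norm _

/-- **No solutions when `Im μ = 0`:** then `Im(μ·ν⁴) = 4·Re μ·(e³f − ef³)` is divisible by `4`.
[folklore] -/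
theorem no_solution_of_im_eq_zero {μ : GaussianInt} (hμ : μ.im = 0) (ν : GaussianInt) :
    ¬ ((μ * ν ^ 4).im = 1 ∨ (μ * ν ^ 4).im = -1) := by
  obtain ⟨a, b⟩ := μ
  obtain ⟨e, f⟩ := ν
  change b = 0 at hμ
  subst hμ
  have h : ((⟨a, 0⟩ : GaussianInt) * (⟨e, f⟩ : GaussianInt) ^ 4).im =
      4 * (a * (e ^ 3 * f - e * f ^ 3)) := by
    simp only [pow_succ, pow_zero, one_mul, Zsqrtd.im_mul, Zsqrtd.re_mul]
    ring
  rw [h]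
  omega

/-! ## The degree-four gap and the Roth step -/

/-- **The degree-four gap.** If `|Im(w·z⁴)| = 1` (`w, z ≠ 0`) then
`‖(z/z̄)⁴ − w̄/w‖ = 2/(‖w‖·‖z‖⁴)`. [folklore] -/
theorem degree_four_gap {w z : ℂ} (hw : w ≠ 0) (hz : z ≠ 0)
    (him : (w * z ^ 4).im = 1 ∨ (w * z ^ 4).im = -1) :
    ‖(z / conj z) ^ 4 - conj w / w‖ = 2 / (‖w‖ * ‖z‖ ^ 4) := by
  have hcz : conj z ≠ 0 := (map_ne_zero _).mpr hz
  have key : (z / conj z) ^ 4 - conj w / w = (w * z ^ 4 - conj (w * z ^ 4)) / (w * conj z ^ 4) := by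
    rw [map_mul, map_pow]
    field_simp
  rw [key, Complex.sub_conj, norm_div, norm_mul, norm_mul, norm_pow, Complex.norm_conj,
    Complex.norm_real, Complex.norm_I, mul_one, Real.norm_eq_abs]
  congr 1
  rcases him with h | h <;> rw [h] <;> norm_num

/-- **The Roth step.** If `α` admits no approximations `|α − m/n| < n⁻³` beyond denominator `N`
(Roth with exponent `3`), and integers `e, f` (`f ≠ 0`) satisfy `0 < |e − αf| ≤ c/|f|³`, then
`|f| ≤ max N c`. [folklore] -/
theorem roth_step {α c : ℝ} {N : ℕ}
    (hN : ∀ n : ℕ, N ≤ n → ∀ m : ℤ, α ≠ m / n → 1 / (n : ℝ) ^ (3 : ℝ) ≤ |α - m / n|)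
    {e f : ℤ} (hf : f ≠ 0) (hne : (e : ℝ) - α * f ≠ 0) (hb : |(e : ℝ) - α * f| ≤ c / |(f : ℝ)| ^ 3) :
    |(f : ℝ)| ≤ max (N : ℝ) c := by
  by_contra hcon
  push Not at hcon
  have hNf : (N : ℝ) < |(f : ℝ)| := lt_of_le_of_lt (le_max_left _ _) hcon
  have hcf : c < |(f : ℝ)| := lt_of_le_of_lt (le_max_right _ _) hcon
  have hf0 : (0 : ℝ) < |(f : ℝ)| := abs_pos.mpr (by exact_mod_cast hf)
  -- denominator `n = |f|`, numerator `m = ±e`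
  set n : ℕ := f.natAbs with hn
  have hnR : (n : ℝ) = |(f : ℝ)| := by simp [hn]
  have hNn : N ≤ n := by exact_mod_cast (hnR ▸ hNf).le
  have hfR : (f : ℝ) ≠ 0 := by exact_mod_cast hf
  obtain ⟨m, hmn⟩ : ∃ m : ℤ, (m : ℝ) / n = e / f := by
    rcases lt_or_gt_of_ne hf with hneg | hpos
    · refine ⟨-e, ?_⟩
      have : (n : ℝ) = -(f : ℝ) := by rw [hnR, abs_of_neg (by exact_mod_cast hneg)]
      rw [this]; push_cast; rw [neg_div_neg_eq]
    · refine ⟨e, ?_⟩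
      have : (n : ℝ) = (f : ℝ) := by rw [hnR, abs_of_pos (by exact_mod_cast hpos)]
      rw [this]
  have hdiff : α - m / n = -(((e : ℝ) - α * f) / f) := by rw [hmn]; field_simp; ring
  have hαne : α ≠ m / n := by
    intro h
    have : α - m / n = 0 := sub_eq_zero.mpr h
    rw [hdiff, neg_eq_zero, div_eq_zero_iff] at this
    rcases this with h1 | h1
    · exact hne h1
    · exact hfR h1
  have key := hN n hNn m hαne
  rw [hdiff, abs_neg, abs_div, show ((3 : ℝ)) = ((3 : ℕ) : ℝ) by norm_num, Real.rpow_natCast,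
    hnR] at key
  -- `1/|f|³ ≤ |e − αf|/|f| ≤ c/|f|⁴`
  have h2 : |(e : ℝ) - α * f| / |(f : ℝ)| ≤ c / |(f : ℝ)| ^ 3 / |(f : ℝ)| :=
    div_le_div_of_nonneg_right hb hf0.le
  have h3 : 1 / |(f : ℝ)| ^ 3 ≤ c / |(f : ℝ)| ^ 3 / |(f : ℝ)| := key.trans h2
  rw [div_div, le_div_iff₀ (by positivity)] at h3
  have h4 : 1 / |(f : ℝ)| ^ 3 * (|(f : ℝ)| ^ 3 * |(f : ℝ)|) = |(f : ℝ)| := by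
    field_simp
  rw [h4] at h3
  linarith

/-! ## Thue's theorem for the harmonic quartic family -/

/-- **Thue's theorem for `Im(μ·ν⁴) = ±1` (from Roth).** For every `μ ∈ ℤ[i]` there is `B` with
`N(ν) ≤ B` for every solution `ν` of `Im(μ·ν⁴) = ±1` — the harmonic quartic Thue equation
`D e⁴ + 4C e³f − 6D e²f² − 4C ef³ + D f⁴ = ±1` (`μ = C + Di`, `ν = e + fi`) has finitely many
solutions.  Ineffective (Roth). [folklore] -/
theorem harmonicThue_norm_bounded (μ : GaussianInt) :
    ∃ B : ℕ, ∀ ν : GaussianInt, ((μ * ν ^ 4).im = 1 ∨ (μ * ν ^ 4).im = -1) → ν.norm ≤ B := by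
  by_cases hμim : μ.im = 0
  · exact ⟨0, fun ν h => (no_solution_of_im_eq_zero hμim ν h).elim⟩
  -- complex data: `w = μ`, `ρ = w̄/w`, a fourth root `ζ₀` of `ρ`, the four roots `ζ k = ζ₀ i^k`
  set w : ℂ := (μ : ℂ) with hw
  have hw0 : w ≠ 0 := by
    intro h
    exact hμim (by rw [GaussianInt.toComplex_eq_zero.mp h]; rfl)
  have hwim : w.im ≠ 0 := by
    intro h
    apply hμim
    have h1 : ((μ.im : ℤ) : ℝ) = 0 := by rw [GaussianInt.intCast_im]; exact h
    exact_mod_cast h1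
  have hwn : 0 < ‖w‖ := norm_pos_iff.mpr hw0
  set ρ : ℂ := conj w / w with hρ
  have hρ1 : ‖ρ‖ = 1 := by
    rw [hρ, norm_div, Complex.norm_conj, div_self hwn.ne']
  obtain ⟨ζ₀, hζ₀⟩ := IsAlgClosed.exists_pow_nat_eq ρ (by norm_num : 0 < 4)
  have hζ₀1 : ‖ζ₀‖ = 1 := by
    have : ‖ζ₀‖ ^ 4 = 1 := by rw [← norm_pow, hζ₀, hρ1]
    exact (pow_eq_one_iff_of_nonneg (norm_nonneg _) (by norm_num)).mp this
  set ζ : Fin 4 → ℂ := fun k => ζ₀ * I ^ (k : ℕ) with hζdef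
  have hζnorm : ∀ k, ‖ζ k‖ = 1 := by
    intro k; simp [hζdef, norm_pow, hζ₀1]
  have hζpow : ∀ k, ζ k ^ 4 = ρ := by
    intro k
    simp only [hζdef]
    rw [mul_pow, ← pow_mul, mul_comm (k : ℕ) 4, pow_mul, Complex.I_pow_four, one_pow, mul_one, hζ₀]
  have hζne1 : ∀ k, ζ k ≠ 1 := by
    intro k h
    have hρ' : ρ = 1 := by rw [← hζpow k, h, one_pow]
    have h2 : conj w = w := by rwa [hρ, div_eq_one_iff_eq hw0] at hρ'
    exact hwim (Complex.conj_eq_iff_im.mp h2)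
  -- the real parameters `α k`, algebraic over `ℚ`
  have hρalg : IsAlgebraic ℚ ρ := by
    rw [hρ, div_eq_mul_inv, hw, ← GaussianInt.toComplex_star]
    exact (isAlgebraic_toComplex _).mul (IsAlgebraic.inv_iff.mpr (isAlgebraic_toComplex _))
  have hζalg : ∀ k, IsAlgebraic ℚ (ζ k) := fun k =>
    IsAlgebraic.of_pow (by norm_num : 0 < 4) (by rw [hζpow]; exact hρalg)
  set α : Fin 4 → ℝ := fun k => 2 * (ζ k).im / Complex.normSq (ζ k - 1) with hαdef
  have hαalg : ∀ k, IsAlgebraic ℚ (α k) := fun k =>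
    isAlgebraic_alphaOf (hζnorm k) (hζne1 k) (hζalg k)
  have hαζ : ∀ k, ((α k : ℂ) + I) / ((α k : ℂ) - I) = ζ k := fun k =>
    moebius_alphaOf (hζnorm k) (hζne1 k)
  -- Roth thresholds with exponent `3`
  have hroth : ∀ k, ∃ N : ℕ, ∀ n : ℕ, N ≤ n → ∀ m : ℤ, α k ≠ m / n →
      1 / (n : ℝ) ^ (3 : ℝ) ≤ |α k - m / n| := fun k =>
    TowerFourSubLiouville.fixedFormsRoth_approx (hαalg k) (by norm_num)
  choose N hN using hroth
  -- constants and the per-root bound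
  set c : Fin 4 → ℝ := fun k => 3 * ‖(α k : ℂ) - I‖ / ‖w‖ with hcdef
  have hc0 : ∀ k, 0 ≤ c k := fun k => by positivity
  set M : Fin 4 → ℝ := fun k => max (N k : ℝ) (c k) with hMdef
  have hM0 : ∀ k, 0 ≤ M k := fun k => (hc0 k).trans (le_max_right _ _)
  set R : Fin 4 → ℝ := fun k => (|α k| * M k + c k) ^ 2 + M k ^ 2 + c k ^ 2 with hRdef
  have hR0 : ∀ k, 0 ≤ R k := fun k => by positivity
  refine ⟨⌈∑ k, R k⌉₊, fun ν hsol => ?_⟩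
  -- a solution: `z = ν ≠ 0`, `|Im(w z⁴)| = 1`
  have hν0 : ν ≠ 0 := by rintro rfl; simp at hsol
  set z : ℂ := (ν : ℂ) with hz
  have hz0 : z ≠ 0 := fun h => hν0 (GaussianInt.toComplex_eq_zero.mp h)
  have hz1 : 1 ≤ ‖z‖ := one_le_norm_toComplex hν0
  have him : (w * z ^ 4).im = 1 ∨ (w * z ^ 4).im = -1 := by
    have hcast : w * z ^ 4 = ((μ * ν ^ 4 : GaussianInt) : ℂ) := by
      rw [hw, hz, map_mul, map_pow]
    rw [hcast, ← GaussianInt.intCast_im]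
    rcases hsol with h | h <;> simp [h]
  -- the gap, the nearest root, the Möbius chart
  have hgap := degree_four_gap hw0 hz0 him
  obtain ⟨k, hk⟩ := exists_near_fourth_root hζ₀1 (z / conj z)
  rw [hζ₀] at hk
  have hqζ : ‖z / conj z - ζ k‖ ≤ 6 / (‖w‖ * ‖z‖ ^ 4) := by
    calc ‖z / conj z - ζ k‖ ≤ 3 * ‖(z / conj z) ^ 4 - ρ‖ := hk
      _ = 6 / (‖w‖ * ‖z‖ ^ 4) := by rw [hgap]; ring
  have hmoeb := norm_div_conj_sub_moebius hz0 (α k)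
  rw [hαζ k] at hmoeb
  -- `|e − α f| ≤ c k / ‖z‖³`
  set e : ℤ := ν.re with he
  set f : ℤ := ν.im with hf
  have hzre : z.re = (e : ℝ) := by rw [he, hz, GaussianInt.intCast_re]
  have hzim : z.im = (f : ℝ) := by rw [hf, hz, GaussianInt.intCast_im]
  have hαI : 0 < ‖(α k : ℂ) - I‖ := norm_pos_iff.mpr (ofReal_sub_I_ne_zero _)
  have hlin : |(e : ℝ) - α k * f| ≤ c k / ‖z‖ ^ 3 := by
    have h1 : 2 * |(e : ℝ) - α k * f| / (‖z‖ * ‖(α k : ℂ) - I‖) ≤ 6 / (‖w‖ * ‖z‖ ^ 4) := by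
      rw [← hzre, ← hzim, ← hmoeb]; exact hqζ
    rw [div_le_div_iff₀ (by positivity) (by positivity)] at h1
    rw [le_div_iff₀ (by positivity), hcdef]
    simp only
    have h2 : 2 * |(e : ℝ) - α k * f| * (‖w‖ * ‖z‖ ^ 4) =
        (|(e : ℝ) - α k * f| * ‖z‖ ^ 3) * (2 * ‖w‖ * ‖z‖) := by ring
    have h3 : 6 * (‖z‖ * ‖(α k : ℂ) - I‖) =
        (3 * ‖(α k : ℂ) - I‖ / ‖w‖) * (2 * ‖w‖ * ‖z‖) := by field_simp; ring
    rw [h2, h3] at h1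
    exact le_of_mul_le_mul_right h1 (by positivity)
  -- `e − α f ≠ 0` (else `q = ζ k`, contradicting the gap)
  have hne : (e : ℝ) - α k * f ≠ 0 := by
    intro h0
    have h1 : ‖z / conj z - ζ k‖ = 0 := by rw [hmoeb, hzre, hzim, h0]; simp
    have h2 : z / conj z = ζ k := by rwa [norm_eq_zero, sub_eq_zero] at h1
    have h3 : ‖(z / conj z) ^ 4 - ρ‖ = 0 := by rw [h2, hζpow, sub_self, norm_zero]
    rw [hgap] at h3
    have : (0 : ℝ) < 2 / (‖w‖ * ‖z‖ ^ 4) := by positivity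
    linarith
  -- bound `|f| ≤ M k` and `|e| ≤ |α| M k + c k`
  have hfz : |(f : ℝ)| ≤ ‖z‖ := by rw [← hzim]; exact Complex.abs_im_le_norm z
  have hfM : |(f : ℝ)| ≤ M k := by
    by_cases hf0 : f = 0
    · rw [hf0]; simp [hM0 k]
    · have hf0' : (0 : ℝ) < |(f : ℝ)| := abs_pos.mpr (by exact_mod_cast hf0)
      refine roth_step (hN k) hf0 hne (hlin.trans ?_)
      exact div_le_div_of_nonneg_left (hc0 k) (by positivity) (by gcongr)
  have hlin' : |(e : ℝ) - α k * f| ≤ c k := by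
    refine hlin.trans ?_
    rw [div_le_iff₀ (by positivity)]
    have : (1 : ℝ) ≤ ‖z‖ ^ 3 := one_le_pow₀ hz1
    nlinarith [hc0 k]
  have heM : |(e : ℝ)| ≤ |α k| * M k + c k := by
    calc |(e : ℝ)| = |((e : ℝ) - α k * f) + α k * f| := by ring_nf
      _ ≤ |(e : ℝ) - α k * f| + |α k * f| := abs_add_le _ _
      _ ≤ c k + |α k| * M k := by
          rw [abs_mul]; exact add_le_add hlin' (mul_le_mul_of_nonneg_left hfM (abs_nonneg _))
      _ = |α k| * M k + c k := by ring
  -- assemble: `N(ν) = e² + f² ≤ R k ≤ ∑ R ≤ ⌈∑ R⌉₊`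
  have hnormR : (ν.norm : ℝ) = (e : ℝ) ^ 2 + (f : ℝ) ^ 2 := by
    rw [Zsqrtd.norm_def, ← he, ← hf]; push_cast; ring
  have hRk : (ν.norm : ℝ) ≤ R k := by
    rw [hnormR, hRdef]
    simp only
    have h1 : (e : ℝ) ^ 2 ≤ (|α k| * M k + c k) ^ 2 := by
      rw [← sq_abs (e : ℝ)]
      exact pow_le_pow_left₀ (abs_nonneg _) heM 2
    have h2 : (f : ℝ) ^ 2 ≤ M k ^ 2 := by
      rw [← sq_abs (f : ℝ)]
      exact pow_le_pow_left₀ (abs_nonneg _) hfM 2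
    nlinarith [hc0 k]
  have hsum : R k ≤ ∑ j, R j :=
    Finset.single_le_sum (fun j _ => hR0 j) (Finset.mem_univ k)
  have hfin : (ν.norm : ℝ) ≤ (⌈∑ j, R j⌉₊ : ℕ) :=
    (hRk.trans hsum).trans (Nat.le_ceil _)
  exact_mod_cast hfin

/-! ## Consequences for the cell -/

/-- **For each `m` the Pell-square cell is finite**: there is `B(m)` with `n ≤ B` whenever
`1 + t² = m·n⁴` (`X² + 1 = mY⁴` has finitely many solutions; Thue 1909).  Proof: by the `ℤ[i]` normal
form the point is a solution of `Im(μν⁴) = 1` with `N(μ) = m`, `N(ν) = n`; there are finitely many `μ`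
of norm `m` (`|Re μ|, |Im μ| ≤ m`), and `harmonicThue_norm_bounded` bounds each. [folklore] -/
theorem cell_modulus_bounded (m : ℕ) : ∃ B : ℕ, ∀ t n : ℕ, 1 + t ^ 2 = m * n ^ 4 → n ≤ B := by
  classical
  -- a bound for every `μ` in the box `|Re μ|, |Im μ| ≤ m`
  choose B hB using harmonicThue_norm_bounded
  let box : Finset (ℤ × ℤ) := (Finset.Icc (-(m : ℤ)) m) ×ˢ (Finset.Icc (-(m : ℤ)) m)
  refine ⟨box.sup fun p => B ⟨p.1, p.2⟩, fun t n hcell => ?_⟩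
  obtain ⟨μ, ν, hμ, hν, him, -⟩ := GaussianNormalForm.thueSolution_of_cell hcell
  have hmem : (μ.re, μ.im) ∈ box := by
    have hnorm : μ.re * μ.re + μ.im * μ.im = m := by
      rw [← hμ, Zsqrtd.norm_def]; ring
    have hm2 : (m : ℤ) ≤ (m : ℤ) ^ 2 := by exact_mod_cast Nat.le_self_pow (by norm_num) m
    have hm0 : (0 : ℤ) ≤ m := by positivity
    have h1 : |μ.re| ≤ m := by
      have hsq : μ.re ^ 2 ≤ (m : ℤ) ^ 2 := by nlinarith [mul_self_nonneg μ.im]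
      have := sq_le_sq.mp hsq
      rwa [abs_of_nonneg hm0] at this
    have h2 : |μ.im| ≤ m := by
      have hsq : μ.im ^ 2 ≤ (m : ℤ) ^ 2 := by nlinarith [mul_self_nonneg μ.re]
      have := sq_le_sq.mp hsq
      rwa [abs_of_nonneg hm0] at this
    simp only [box, Finset.mem_product, Finset.mem_Icc]
    exact ⟨abs_le.mp h1, abs_le.mp h2⟩
  have key : ν.norm ≤ B μ := hB μ ν (Or.inl him)
  rw [hν] at key
  have hle : B ⟨μ.re, μ.im⟩ ≤ box.sup fun p => B ⟨p.1, p.2⟩ :=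
    Finset.le_sup (f := fun p : ℤ × ℤ => B ⟨p.1, p.2⟩) hmem
  have hμeta : (⟨μ.re, μ.im⟩ : GaussianInt) = μ := rfl
  rw [hμeta] at hle
  have hfin : (n : ℤ) ≤ ((box.sup fun p => B ⟨p.1, p.2⟩ : ℕ) : ℤ) := key.trans (by exact_mod_cast hle)
  exact_mod_cast hfin

/-- **The cofactor of a fourth-power divisor of `t² + 1` is unbounded** (the Thue stratum of `W₄`):
for every `B` there is `X₀` with `t ≤ X₀` whenever `n > 0`, `n⁴ ∣ t² + 1` and `(t² + 1)/n⁴ ≤ B`.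
Ineffective, no rate — `W₄` (`quarticRootWall_of_uniformSadicTowerFour`) is the rate `n³ ≪_ε t^(1+ε)`.
[folklore] -/
theorem quarticRoot_cofactor_unbounded (B : ℕ) :
    ∃ X₀ : ℕ, ∀ t n : ℕ, 0 < n → n ^ 4 ∣ t ^ 2 + 1 → (t ^ 2 + 1) / n ^ 4 ≤ B → t ≤ X₀ := by
  classical
  choose N hN using cell_modulus_bounded
  -- `X₀² ≥ B · (max_{m ≤ B} N m)⁴`
  set K : ℕ := (Finset.range (B + 1)).sup N with hK
  refine ⟨B * K ^ 4, fun t n hn hdvd hB => ?_⟩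
  obtain ⟨m, hm⟩ := hdvd
  have hn4 : 0 < n ^ 4 := pow_pos hn 4
  have hmeq : (t ^ 2 + 1) / n ^ 4 = m := by
    rw [hm, Nat.mul_div_cancel_left _ hn4]
  rw [hmeq] at hB
  have hcell : 1 + t ^ 2 = m * n ^ 4 := by rw [add_comm, hm]; ring
  have hnN : n ≤ N m := hN m t n hcell
  have hNK : N m ≤ K := Finset.le_sup (f := N) (Finset.mem_range.mpr (Nat.lt_succ_of_le hB))
  have hnK : n ≤ K := hnN.trans hNK
  -- `t ≤ t² < t² + 1 = m n⁴ ≤ B K⁴`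
  have h1 : t ≤ t ^ 2 + 1 := by nlinarith
  calc t ≤ t ^ 2 + 1 := h1
    _ = m * n ^ 4 := by rw [← hcell, add_comm]
    _ ≤ B * K ^ 4 := Nat.mul_le_mul hB (Nat.pow_le_pow_left hnK 4)

end Summit.ABC.ABC.Theorems.UniformSadicTowerFour.HarmonicThueRoth
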